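import Summits.NavierStokesRegularity.NavierStokesRegularity.Theses.RellichScar
import Summits.NavierStokesRegularity.NavierStokesRegularity.Theorems.ScarRigidity.Negative.LogicAndLoadBearing
import Summits.NavierStokesRegularity.NavierStokesRegularity.Theorems.ScarRigidity.Negative.ApexLiouvilleVacuity
import Summits.NavierStokesRegularity.NavierStokesRegularity.Theorems.ScarRigidity.Negative.NeutralMode
import Summits.NavierStokesRegularity.NavierStokesRegularity.Theorems.RellichScarScarRigidityScarTwinsFlatness
import Summits.NavierStokesRegularity.NavierStokesRegularity.Theorems.RellichScarScarRigidityLinearRigidityReduction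
import Summits.NavierStokesRegularity.NavierStokesRegularity.Theorems.RellichScarScarRigidityGeneratorHullReduction
import Summits.NavierStokesRegularity.NavierStokesRegularity.Theorems.RellichScarSymmetricScarExistsOrbitScarRigidity
import HarnessLib

/-!
# Redirect strategist r1 — typed census for crux `ScarRigidity` (stmt-NavierStokesRegularity-11717, route RellichScar)

Companion of `STRATEGY-CENSUS.md` (same directory).  Everything here is sorry-free and assembled from LANDED
tree theorems only; it TYPES the statements the census discusses and kernel-checks the logical relations it
claims.  Nothing here is a line (no `stub_*`, no `ScarRigidity_of`).

* §P  LOGICAL POSITION — `scarRigidity_of_target` (route target `NoApexTypeIProfile` ⇒ crux: the crux is the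
      target's vacuous shadow), `scarRigidity_iff_slices_above` (below any apex-Liouville threshold the crux IS its
      large-constant slices; the target's small-constant slices hold by the same Liouville statement).
* §D  DECOMPOSITION — the best typed split `AOF ∧ FSR ⇒ crux` (assembly = landed
      `scarRigidity_of_allOrdersFlat_of_flatRigidity`, p123667), and the only registered skeleton's shape
      `SymmetricScarExists ∧ (LR ∨ S1) ⇒ crux`, whose proof goes THROUGH the target (`by_contra` +
      `exists_singular_apex_of_not_scarRigidity`).
* §S  STRENGTHENINGS typed — `SingularityFreeScarRigidity` (drop both singular origins), `RateClassScarRigidity`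
      (rate instead of apex bound), `LinearRigidityAtApexProfile` (LR), `IsolationAmongTwins` (S1); each with its
      calibration against the crux.
* §W  THE WEAKER FORM the route actually consumes — `OrbitScarRigidity` (ORBIT-SR) with `crux ⇒ ORBIT-SR`
      (landed `orbitScarRigidity_of_scarRigidity`); `closes_of_orbitScarRigidity` (p137867) re-proves the route's
      deciding theorem from it.
* §N  NEGATION certificates in tree — size-level non-rigidity (`neutralModeRigidity_false`,
      `differenceInequalityRigidity_false`, constant 30) and irrefutability short of a Type-I profile
      (`exists_singular_apex_of_not_scarRigidity`).
-/

noncomputable section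

open Set Filter Function MeasureTheory Metric TopologicalSpace
open scoped Topology ENNReal NNReal InnerProductSpace RealInnerProductSpace Laplacian

set_option linter.dupNamespace false

namespace Summit.NavierStokesRegularity.NavierStokesRegularity.Cruxes.ScarRigidity.StrategistR1

open Literature.Analysis.FluidPDE
open Summit.NavierStokesRegularity.NavierStokesRegularity.Theses.RellichScar
open Summit.NavierStokesRegularity.NavierStokesRegularity.Theorems.ScarRigidity.Negative
open Summit.NavierStokesRegularity.NavierStokesRegularity.Theorems.RellichScarScarRigidity

/-- Physical space. -/
local notation "ℝ³" => EuclideanSpace ℝ (Fin 3)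

/-- The open backward slab `(-∞,0) × ℝ³`. -/
local notation "𝕊" => Literature.Analysis.FluidPDE.slab (EuclideanSpace ℝ (Fin 3)) (Set.Iio (0 : ℝ)) isOpen_Iio

/-! ## §P Logical position -/

/-- **Target ⇒ crux.**  `NoApexTypeIProfile` (item 11716, the route's "it suffices to show") implies
`ScarRigidity` — vacuously: the crux quantifies over PAIRS of singular apex profiles, and the target says
there is none.  (One line over the landed `scarRigidity_or_exists_singular_apex`.) -/
theorem scarRigidity_of_target (hX : NoApexTypeIProfile) : ScarRigidity := by
  rcases scarRigidity_or_exists_singular_apex with h | ⟨C, u, p, G, _, hs, hg, hI, hd, hsing⟩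
  · exact h
  · exact absurd hsing (hX u p G C hs hg hI hd)

/-- **The crux lives exactly where the target is open.**  Below an apex-Liouville threshold `C₀` the crux is
equivalent to its slices `C₀ ≤ C` (landed `scarRigidity_iff_above_liouville`), and the target's slices
`C < C₀` hold by the same statement (`noApexTypeIProfile_below_of_apexLiouville`).  With the certified
`C₀ ≈ 1.16` (Disproof §8) the two statements are decided on the same slices and open on the same slices. -/
theorem scarRigidity_iff_slices_above {C₀ : ℝ} (h : ApexLiouville C₀) :
    ScarRigidity ↔ ∀ C : ℝ, C₀ ≤ C → ScarRigidityAt C :=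
  scarRigidity_iff_above_liouville h

example {C₀ : ℝ} (h : ApexLiouville C₀) := noApexTypeIProfile_below_of_apexLiouville h

/-! ## §D Decomposition — the best typed split -/

/-- **AOF** (all-orders flatness): quartically flat scar twins — two smooth Type-I ancient mild apex profiles at
the same constant, classical with the scale-invariant package, both singular at the origin, `FarDecay 4` — are
flat to every order.  Verbatim the first hypothesis of the landed `scarRigidity_of_allOrdersFlat_of_flatRigidity`. -/
def AOF : Prop :=
  ∀ (V₁ V₂ : ℝ → ℝ³ → ℝ³) (Q₁ Q₂ : ℝ → ℝ³ → ℝ) (C : ℝ), 0 < C →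
    IsTypeIAncientMild C V₁ → IsTypeIAncientMild C V₂ → HasTypeIDecay C V₁ → HasTypeIDecay C V₂ →
    IsClassicalNSSolutionOn (Iio (0 : ℝ)) 1 0 V₁ Q₁ → IsClassicalNSSolutionOn (Iio (0 : ℝ)) 1 0 V₂ Q₂ →
    ScaleInvariantBounds V₁ Q₁ → ScaleInvariantBounds V₂ Q₂ →
    IsBackwardSingularPoint V₁ 0 → IsBackwardSingularPoint V₂ 0 →
    FarDecay 4 V₁ V₂ → ∀ N : ℕ, FarDecay N V₁ V₂

/-- **FSR** (flat scar rigidity): all-orders-flat twins coincide — unique continuation from spatial infinity for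
the EXACT difference system across the parabolic core.  Verbatim the second hypothesis of the same theorem. -/
def FSR : Prop :=
  ∀ (V₁ V₂ : ℝ → ℝ³ → ℝ³) (Q₁ Q₂ : ℝ → ℝ³ → ℝ) (C : ℝ), 0 < C →
    IsTypeIAncientMild C V₁ → IsTypeIAncientMild C V₂ → HasTypeIDecay C V₁ → HasTypeIDecay C V₂ →
    IsClassicalNSSolutionOn (Iio (0 : ℝ)) 1 0 V₁ Q₁ → IsClassicalNSSolutionOn (Iio (0 : ℝ)) 1 0 V₂ Q₂ →
    ScaleInvariantBounds V₁ Q₁ → ScaleInvariantBounds V₂ Q₂ →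
    IsBackwardSingularPoint V₁ 0 → IsBackwardSingularPoint V₂ 0 →
    (∀ N : ℕ, FarDecay N V₁ V₂) → ∀ t < 0, ∀ x : ℝ³, V₁ t x = V₂ t x

/-- **The split's assembly is a tree theorem** (p123667): `AOF → FSR → ScarRigidity`. -/
theorem scarRigidity_of_AOF_FSR : AOF → FSR → ScarRigidity :=
  scarRigidity_of_allOrdersFlat_of_flatRigidity

/-! ## §S Strengthenings, typed, with their calibration against the crux -/

/-- **S⁺₁ singularity-free form**: the crux with BOTH `IsBackwardSingularPoint` hypotheses deleted (backward
uniqueness with non-trivial final data in the whole apex class).  Regular–regular pairs are Lei–Yang–Yuan 2024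
Thm 1.1 territory (bounded mild up to the final time; not in tree), mixed pairs are `NoMildScar` (item 11723);
the singular–singular pairs are the crux.  So the added generality is known-or-routine and the hard case is unchanged. -/
def SingularityFreeScarRigidity : Prop :=
  ∀ (u₁ : ℝ → ℝ³ → ℝ³) (p₁ : ℝ → ℝ³ → ℝ) (G₁ : ℝ → ℝ³ → ℝ³ →L[ℝ] ℝ³)
    (u₂ : ℝ → ℝ³ → ℝ³) (p₂ : ℝ → ℝ³ → ℝ) (G₂ : ℝ → ℝ³ → ℝ³ →L[ℝ] ℝ³) (C : ℝ),
    IsSuitableWeakSolutionOn 𝕊 1 0 u₁ p₁ → HasWeakSpatialGradientOn 𝕊 u₁ G₁ →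
    typeIBound (Iio (0 : ℝ) ×ˢ univ) u₁ p₁ G₁ < ⊤ → HasTypeIDecay C u₁ →
    IsSuitableWeakSolutionOn 𝕊 1 0 u₂ p₂ → HasWeakSpatialGradientOn 𝕊 u₂ G₂ →
    typeIBound (Iio (0 : ℝ) ×ˢ univ) u₂ p₂ G₂ < ⊤ → HasTypeIDecay C u₂ →
    SameScar u₁ u₂ → AeEqSlab u₁ u₂

/-- Calibration: S⁺₁ ⇒ crux (forget the singular origins). -/
theorem scarRigidity_of_singularityFree (h : SingularityFreeScarRigidity) : ScarRigidity :=
  fun u₁ p₁ G₁ u₂ p₂ G₂ C hs₁ hg₁ hI₁ hd₁ hs₂ hg₂ hI₂ hd₂ _ _ hscar =>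
    h u₁ p₁ G₁ u₂ p₂ G₂ C hs₁ hg₁ hI₁ hd₁ hs₂ hg₂ hI₂ hd₂ hscar

/-- **S⁺₂ rate-class form**: the crux over the Type-I RATE class (`‖u‖ ≤ C/√(−t)`, keep `𝐈 < ∞`) instead of the
apex class.  Strictly more pairs; a counterexample would be an Albritton–Barker Type-I singularity (open either way);
its coefficients are unbounded along the whole final-time singular set, not only at the apex. -/
def RateClassScarRigidity : Prop :=
  ∀ (u₁ : ℝ → ℝ³ → ℝ³) (p₁ : ℝ → ℝ³ → ℝ) (G₁ : ℝ → ℝ³ → ℝ³ →L[ℝ] ℝ³)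
    (u₂ : ℝ → ℝ³ → ℝ³) (p₂ : ℝ → ℝ³ → ℝ) (G₂ : ℝ → ℝ³ → ℝ³ →L[ℝ] ℝ³) (C : ℝ),
    IsSuitableWeakSolutionOn 𝕊 1 0 u₁ p₁ → HasWeakSpatialGradientOn 𝕊 u₁ G₁ →
    typeIBound (Iio (0 : ℝ) ×ˢ univ) u₁ p₁ G₁ < ⊤ → HasTypeITimeDecay C u₁ →
    IsSuitableWeakSolutionOn 𝕊 1 0 u₂ p₂ → HasWeakSpatialGradientOn 𝕊 u₂ G₂ →
    typeIBound (Iio (0 : ℝ) ×ˢ univ) u₂ p₂ G₂ < ⊤ → HasTypeITimeDecay C u₂ →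
    IsBackwardSingularPoint u₁ 0 → IsBackwardSingularPoint u₂ 0 →
    SameScar u₁ u₂ → AeEqSlab u₁ u₂

/-- Calibration: S⁺₂ ⇒ crux (an apex bound with `0 < C` is a rate bound; `0 < C` from the singular origin). -/
theorem scarRigidity_of_rateClass (h : RateClassScarRigidity) : ScarRigidity := by
  intro u₁ p₁ G₁ u₂ p₂ G₂ C hs₁ hg₁ hI₁ hd₁ hs₂ hg₂ hI₂ hd₂ hsing₁ hsing₂ hscar
  have hC : 0 < C := pos_const_of_apexSingular hd₁ hsing₁
  exact h u₁ p₁ G₁ u₂ p₂ G₂ C hs₁ hg₁ hI₁ (hd₁.hasTypeITimeDecay hC.le) hs₂ hg₂ hI₂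
    (hd₂.hasTypeITimeDecay hC.le) hsing₁ hsing₂ hscar

/-- **S⁺₃ = LR, X-Liouville for the EXACT linearisation at a true singular apex profile** (the right disjunct of the
registered stub `stub_isolationOrLinearRigidity`, verbatim; the PROMOTE spec of leads a3/c6/c7). -/
def LinearRigidityAtApexProfile : Prop :=
  ∀ (V : ℝ → ℝ³ → ℝ³) (Q : ℝ → ℝ³ → ℝ) (C : ℝ), 0 < C →
    IsTypeIAncientMild C V → HasTypeIDecay C V → IsClassicalNSSolutionOn (Iio (0 : ℝ)) 1 0 V Q →
    ScaleInvariantBounds V Q → IsBackwardSingularPoint V 0 →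
    ∀ (Z : ℝ → ℝ³ → ℝ³) (P : ℝ → ℝ³ → ℝ) (K : ℝ),
      IsSmoothSpaceTimeOn (Iio (0 : ℝ)) Z → IsSmoothSpaceTimeOn (Iio (0 : ℝ)) P →
      (∀ t < 0, VectorCalculus.IsDivFree (Z t)) →
      (∀ t < 0, ∀ x : ℝ³, deriv (fun s => Z s x) t + convect (V t) (Z t) x + convect (Z t) (V t) x =
          (Δ (Z t)) x - gradient (P t) x) →
      (∀ t < 0, ∀ x : ℝ³, ‖Z t x‖ ≤ K * ((-t) / (‖x‖ + Real.sqrt (-t)) ^ 3)) →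
      ∀ t < 0, ∀ x : ℝ³, Z t x = 0

/-- **S⁺₄ = S1, isolation among singular scar twins** in the weighted sup-norm (left disjunct, verbatim). -/
def IsolationAmongTwins : Prop :=
  ∀ (V : ℝ → ℝ³ → ℝ³) (Q : ℝ → ℝ³ → ℝ) (C : ℝ), 0 < C →
    IsTypeIAncientMild C V → HasTypeIDecay C V → IsClassicalNSSolutionOn (Iio (0 : ℝ)) 1 0 V Q →
    ScaleInvariantBounds V Q → IsBackwardSingularPoint V 0 →
    ∃ ε : ℝ, 0 < ε ∧ ∀ (V' : ℝ → ℝ³ → ℝ³) (Q' : ℝ → ℝ³ → ℝ),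
      IsTypeIAncientMild C V' → HasTypeIDecay C V' → IsClassicalNSSolutionOn (Iio (0 : ℝ)) 1 0 V' Q' →
      ScaleInvariantBounds V' Q' → IsBackwardSingularPoint V' 0 → SameScar V' V →
      (∀ t < 0, ∀ x : ℝ³, ‖V' t x - V t x‖ ≤ ε * ((-t) / (‖x‖ + Real.sqrt (-t)) ^ 3)) →
      ∀ t < 0, ∀ x : ℝ³, V' t x = V t x

/-- **The only registered skeleton's shape, linear disjunct**: `SymmetricScarExists ∧ LR ⇒ crux` (landed p131641).
Its proof is `by_contra` + `exists_singular_apex_of_not_scarRigidity`: it proves the crux BY PROVING THAT NO SINGULAR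
APEX PROFILE EXISTS, i.e. through the route target. -/
theorem scarRigidity_of_SSE_LR (hZ : SymmetricScarExists) (hLR : LinearRigidityAtApexProfile) : ScarRigidity :=
  scarRigidity_of_symmetricScarExists_of_linearRigidity hZ hLR

/-- Same shape, isolation disjunct: `SymmetricScarExists ∧ S1 ⇒ crux` (landed p130786). -/
theorem scarRigidity_of_SSE_S1 (hZ : SymmetricScarExists) (hS1 : IsolationAmongTwins) : ScarRigidity :=
  scarRigidity_of_symmetricScarExists_of_isolation hZ hS1

/-! ## §W The weaker form the route consumes -/

/-- **ORBIT-SR**: scar rigidity for orbit-internal pairs `(R_θ D_c u, u)`, `0 < c` — verbatim the first hypothesis of the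
landed `closes_of_orbitScarRigidity` (p137867), which re-proves `RellichScar.closes` with `ScarRigidity` replaced by it. -/
def OrbitScarRigidity : Prop :=
  ∀ (u : ℝ → EuclideanSpace ℝ (Fin 3) → EuclideanSpace ℝ (Fin 3)) (p : ℝ → EuclideanSpace ℝ (Fin 3) → ℝ)
    (G : ℝ → EuclideanSpace ℝ (Fin 3) → EuclideanSpace ℝ (Fin 3) →L[ℝ] EuclideanSpace ℝ (Fin 3)) (C c θ : ℝ),
    IsSuitableWeakSolutionOn (slab (EuclideanSpace ℝ (Fin 3)) (Iio 0) isOpen_Iio) 1 0 u p →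
    HasWeakSpatialGradientOn (slab (EuclideanSpace ℝ (Fin 3)) (Iio 0) isOpen_Iio) u G →
    typeIBound (Iio (0 : ℝ) ×ˢ univ) u p G < ⊤ → HasTypeIDecay C u → IsBackwardSingularPoint u 0 → 0 < c →
    (∀ K : Set (EuclideanSpace ℝ (Fin 3)), IsCompact K → (0 : EuclideanSpace ℝ (Fin 3)) ∉ K →
      Tendsto (fun δ : ℝ => eLpNorm (uncurry (fun t x => rotZ θ (nsRescale c u t (rotZ (-θ) x))) - uncurry u) ⊤
        (volume.restrict (Ioo (-δ) 0 ×ˢ K))) (nhdsWithin 0 (Ioi 0)) (nhds 0)) →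
    uncurry (fun t x => rotZ θ (nsRescale c u t (rotZ (-θ) x))) =ᵐ[volume.restrict (Iio (0 : ℝ) ×ˢ univ)] uncurry u

/-- Calibration: crux ⇒ ORBIT-SR (landed). -/
theorem orbitScarRigidity_of_crux (h : ScarRigidity) : OrbitScarRigidity :=
  Summit.NavierStokesRegularity.NavierStokesRegularity.Theorems.SymmetricScarExists.RdssSplit.Orbit.orbitScarRigidity_of_scarRigidity h

/-- ORBIT-SR suffices for the route's deciding theorem (landed `closes_of_orbitScarRigidity`, p137867). -/
theorem summit_of_orbitScarRigidity (hOrb : OrbitScarRigidity) (hZ : SymmetricScarExists) (hLoc : ApexLocalisation)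
    (hII : NoTypeII) (hCov : SimilarityCovariance) (hSS : SelfSimilarApexFatal) (hAx : AxisymmetricApexFatal)
    (hP : TypeIBlowupProfile) (hClay : ClayFromNoBlowup) : _root_.NavierStokesRegularity :=
  Summit.NavierStokesRegularity.NavierStokesRegularity.Theorems.SymmetricScarExists.RdssSplit.Orbit.closes_of_orbitScarRigidity
    hOrb hZ hLoc hII hCov hSS hAx hP hClay

/-! ## §N Negation certificates (tree) -/

/-- Size-level linear rigidity is FALSE at potential size 30 (explicit zero-scar neutral mode, Disproof §7). -/
example : ¬ NeutralModeRigidity 30 := neutralModeRigidity_false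

/-- The physical-variables difference INEQUALITY with a critical potential of size 30 is NOT rigid, even with the apex
Type-I bound, cubic flatness (zero scar), finite energy and a singular apex. -/
example : ¬ DifferenceInequalityRigidity 30 := differenceInequalityRigidity_false

/-- Any refutation of the crux exhibits a singular Type-I apex profile (none is known): the direct negation is
obstructed by the route target itself. -/
example (h : ¬ ScarRigidity) := exists_singular_apex_of_not_scarRigidity h

end Summit.NavierStokesRegularity.NavierStokesRegularity.Cruxes.ScarRigidity.StrategistR1

end
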